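import Summits.QuantumAdvantage.AdviceFreeQNC0.KernelFibration
import Summits.QuantumAdvantage.AdviceFreeQNC0.HardcoreCylinder
import Summits.QuantumAdvantage.AdviceFreeQNC0.AffBells22HardcoreWords
import Summits.QuantumAdvantage.AdviceFreeQNC0.AffBells21GenericPath
import HarnessLib

/-!
# Cell qa-qnc0, frame second moment (ROUND-21 §3): (HC-mgf) and (HC-Z) — exponential moments of the zeros of the kernel
line — planner qa-qnc0-p1 g22, `Sketch22.lean` §2, statements VERBATIM

Support for crux `RingDenseResidualLt3` (stmt-QuantumAdvantage-22907), route `DWalkThree`, rung candidate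
`RingFrameAffineLt3` (R-frame): the two transfer-matrix moment bounds of the frame plan (`FramePlan`), which control the
error terms of the frame expansion (SPAN-Φ) averaged over the fibre label `J`.

PROVED here (0 sorry), both UNCONDITIONAL:
* **`kernelZerosOnSetMGF : KernelZerosOnSetMGF`** — `Σ_{x odd} 2^{−|D ∩ zeros J(x)|} ≤ (160/29)·(29/32)^{|D|}·2^{n−1}`;
* **`kernelZerosMGF : KernelZerosMGF`** — `Σ_{x odd} (√3/2)^{Z(J(x))} ≤ (160/39)·(39/40)^n·2^{n−1}`.
Proof: the FIBRE BOUND `sum_odd_le_sum_hardCore` (every fibre `{x odd : J(x) = v}` has `≤ 2^{Z(v)}` elements,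
`Fib19.card_fibre_le`, and `J(x)` is hard-core, `Fib19.kline_hardCore`) turns both sums into weighted sums over hard-core words,
which are linear words without two consecutive zeros (`noAdj_of_hardCore`); the weights are `1` on `D` / `2` off `D`
(`two_pow_mul_half_pow_eq`), resp. `√3 ≤ 7/4` everywhere (`two_pow_mul_sqrt_pow_le`); the two-state transfer potential of
`AffBells22HardcoreWords` (`total_le_two_one`, `total_le_seven_quarters`) does the rest.  The rates `29/32` and `39/40` are
not sharp (the kit's `‖·‖ = .884`, `.954`); only `κ < 1` is claimed by the statements.

WHAT THIS IS NOT: the frame plan itself (`FramePlan`, `RingFrameAffineLt3`) needs the CLASS version of SPAN-Φ (not yet typed);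
nothing here touches the crux.
-/

namespace Summit.QuantumAdvantage.AdviceFreeQNC0

open Finset Literature.Computability.QuantumComplexity Literature.Computability.QuantumComplexity.RingHLF
open Literature.Computability.MetaComplexity

namespace AffBells22

/-! ## Statements (planner qa-qnc0-p1 g22, Sketch22.lean §2 — VERBATIM) -/

/-- **(HC-mgf) EXPONENTIAL MOMENT OF THE COINS ON A SET** (support; transfer matrices with particle weight `2·½ = 1` on the sites
of `D`: `‖[[1,1],[1,0]]/2‖₂ = 0.884` in the eigenbasis of `T`): `E_{x odd} 2^{−|D ∩ zeros(J(x))|} ≤ C·κ^{|D|}`, `κ < 1` absolute.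
Controls the frame-expansion error `Σ_{t≠0} E_J 2^{−wt((tV)|_{P(J)})}` by `3^m·C·κ^{δN}`. -/
def KernelZerosOnSetMGF : Prop :=
  open scoped Classical in
  ∃ κ : ℝ, κ < 1 ∧ ∃ C : ℝ, ∀ n ≥ 3, ∀ D : Finset (Fin n),
    ∑ x ∈ (univ.filter fun x : Fin n → Bool => Fib19.IsOdd x),
        ((2 : ℝ)⁻¹) ^ (D.filter fun i => Fib19.kline x i = false).card ≤ C * κ ^ D.card * (2 : ℝ) ^ (n - 1)

/-- **(HC-Z) FEW-COIN TAIL** (support; particle weight `2·(√3/2) = √3`, spectral radius `(1+√(1+4√3))/4 = 0.954 < 1`):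
`E_{x odd} (√3/2)^{Z(J(x))} ≤ C·κ^n` — controls the parity-class correction of the frame expansion. -/
def KernelZerosMGF : Prop :=
  open scoped Classical in
  ∃ κ : ℝ, κ < 1 ∧ ∃ C : ℝ, ∀ n ≥ 3,
    ∑ x ∈ (univ.filter fun x : Fin n → Bool => Fib19.IsOdd x),
        (Real.sqrt 3 / 2) ^ Fib19.zeros (Fib19.kline x) ≤ C * κ ^ n * (2 : ℝ) ^ (n - 1)

/-! ## The fibre bound: from odd patterns to hard-core words -/

open scoped Classical

variable {n : ℕ}

/-- **Fibre bound**: a non-negative statistic of the kernel line summed over the odd class is at most the same statistic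
summed over hard-core words `v` with weight `2^{Z(v)}` (`Fib19.card_fibre_le`, `Fib19.kline_hardCore`). -/
theorem sum_odd_le_sum_hardCore (hn : 3 ≤ n) (f : (Fin n → Bool) → ℝ) (hf : ∀ v, 0 ≤ f v) :
    ∑ x ∈ (univ.filter fun x : Fin n → Bool => Fib19.IsOdd x), f (Fib19.kline x)
      ≤ ∑ v ∈ (univ.filter fun v : Fin n → Bool => Fib19.HardCore v), (2 : ℝ) ^ Fib19.zeros v * f v := by
  have hmaps : ∀ x ∈ (univ.filter fun x : Fin n → Bool => Fib19.IsOdd x),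
      Fib19.kline x ∈ (univ.filter fun v : Fin n → Bool => Fib19.HardCore v) := by
    intro x hx
    rw [mem_filter] at hx ⊢
    exact ⟨mem_univ _, Fib19.kline_hardCore hn x hx.2⟩
  rw [← sum_fiberwise_of_maps_to hmaps]
  refine sum_le_sum fun v _ => ?_
  have hconst : ∑ x ∈ (univ.filter fun x : Fin n → Bool => Fib19.IsOdd x).filter (fun x => Fib19.kline x = v),
      f (Fib19.kline x) = ((univ.filter fun x : Fin n → Bool => Fib19.IsOdd x ∧ Fib19.kline x = v).card : ℝ) * f v := by
    rw [Finset.filter_filter]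
    rw [sum_congr rfl fun x hx => by rw [(mem_filter.mp hx).2.2], sum_const, nsmul_eq_mul]
  rw [hconst]
  refine mul_le_mul_of_nonneg_right ?_ (hf v)
  exact_mod_cast Fib19.card_fibre_le hn v

/-- Hard-core (cyclic) words have no two consecutive zeros (linear constraint). -/
theorem noAdj_of_hardCore {v : Fin n → Bool} (hv : Fib19.HardCore v) : NoAdj v := by
  intro i hi hbad
  apply hv.1 i
  have hnxt : nxt i = ⟨i.val + 1, hi⟩ := by
    apply Fin.ext
    show (i.val + 1) % n = i.val + 1
    exact Nat.mod_eq_of_lt hi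
  rw [hnxt]
  exact hbad

/-- From hard-core words to all linear no-two-zeros words. -/
theorem sum_hardCore_le_total (w : ℕ → ℝ) (hw : ∀ i, 0 ≤ w i) :
    ∑ v ∈ (univ.filter fun v : Fin n → Bool => Fib19.HardCore v), wordWt w v
      ≤ ∑ v : Fin n → Bool, (if NoAdj v then wordWt w v else 0) := by
  rw [← sum_filter]
  exact sum_le_sum_of_subset_of_nonneg
    (fun v hv => mem_filter.mpr ⟨mem_univ _, noAdj_of_hardCore (mem_filter.mp hv).2⟩)
    (fun v _ _ => wordWt_nonneg hw v)

/-! ## (HC-mgf) -/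

/-- The site weights of (HC-mgf): `1` on `D`, `2` elsewhere (positions coded in `ℕ`). -/
noncomputable def wtD (D : Finset (Fin n)) (i : ℕ) : ℝ := if i ∈ D.map Fin.valEmbedding then 1 else 2

/-- The statistic of (HC-mgf) as a word weight: `2^{Z(v)} · 2^{−Z_D(v)} = Π_{i : v_i = 0} w^D_i`. -/
theorem two_pow_mul_half_pow_eq (D : Finset (Fin n)) (v : Fin n → Bool) :
    (2 : ℝ) ^ Fib19.zeros v * ((2 : ℝ)⁻¹) ^ (D.filter fun i => v i = false).card = wordWt (wtD D) v := by
  unfold Fib19.zeros wordWt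
  have hD : (D.filter fun i => v i = false) = univ.filter fun i => i ∈ D ∧ v i = false := by
    ext i; simp
  rw [hD, AffBells21.pow_card_filter_eq_prod_ite, AffBells21.pow_card_filter_eq_prod_ite, ← prod_mul_distrib]
  refine prod_congr rfl fun i _ => ?_
  have hmem : (i.val ∈ D.map Fin.valEmbedding) ↔ i ∈ D := by
    rw [Finset.mem_map]
    constructor
    · rintro ⟨k, hk, hkv⟩
      have : k = i := Fin.ext (by simpa using hkv)
      exact this ▸ hk
    · intro hi
      exact ⟨i, hi, rfl⟩
  unfold wtD
  by_cases hv : v i = false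
  · by_cases hi : i ∈ D
    · simp [hv, hi, hmem]
    · simp [hv, hi, hmem]
  · simp [hv]

/-- **(HC-mgf) PROVED**: `Σ_{x odd} 2^{−|D ∩ zeros J(x)|} ≤ (160/29)·(29/32)^{|D|}·2^{n−1}` for `n ≥ 3`. -/
theorem kernelZerosOnSetMGF : KernelZerosOnSetMGF := by
  refine ⟨29 / 32, by norm_num, 160 / 29, fun n hn D => ?_⟩
  obtain ⟨m, rfl⟩ : ∃ m, n = m + 1 := ⟨n - 1, by omega⟩
  have hw0 : ∀ i, 0 ≤ wtD D i := fun i => by unfold wtD; split_ifs <;> norm_num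
  have hw2 : ∀ i, wtD D i ≤ 2 := fun i => by unfold wtD; split_ifs <;> norm_num
  have hL : ∀ i ∈ D.map Fin.valEmbedding, wtD D i ≤ 1 := fun i hi => by unfold wtD; rw [if_pos hi]
  -- fibre bound and passage to linear words
  have h1 := sum_odd_le_sum_hardCore hn (fun v => ((2 : ℝ)⁻¹) ^ (D.filter fun i => v i = false).card)
    (fun v => by positivity)
  simp_rw [two_pow_mul_half_pow_eq] at h1
  have h2 := sum_hardCore_le_total (n := m + 1) (wtD D) hw0
  have h3 := total_le_two_one (wtD D) hw0 hw2 (D.map Fin.valEmbedding) hL m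
  -- the filtered set `L ∩ [1, m]` has at least `|D| − 1` elements
  set d := ((D.map Fin.valEmbedding).filter fun i => 1 ≤ i ∧ i ≤ m).card with hd
  have hdcard : D.card ≤ d + 1 := by
    have hsub : (D.map Fin.valEmbedding) ⊆ insert 0 ((D.map Fin.valEmbedding).filter fun i => 1 ≤ i ∧ i ≤ m) := by
      intro i hi
      rw [mem_insert, mem_filter]
      by_cases h0 : i = 0
      · exact Or.inl h0
      · refine Or.inr ⟨hi, by omega, ?_⟩
        obtain ⟨k, _, rfl⟩ := Finset.mem_map.mp hi
        have := k.2
        simp only [Fin.valEmbedding_apply]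
        omega
    have := (card_le_card hsub).trans (card_insert_le _ _)
    rw [card_map] at this
    omega
  have hκ : (29 / 32 : ℝ) ^ d ≤ (32 / 29) * (29 / 32 : ℝ) ^ D.card := by
    have h := pow_le_pow_of_le_one (by norm_num : (0 : ℝ) ≤ 29 / 32) (by norm_num) (by omega : D.card - 1 ≤ d)
    refine h.trans ?_
    rcases Nat.eq_zero_or_pos D.card with hz | hpos
    · rw [hz]; norm_num
    · have : (29 / 32 : ℝ) ^ D.card = (29 / 32) * (29 / 32 : ℝ) ^ (D.card - 1) := by
        rw [← pow_succ']; congr 1; omega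
      rw [this]
      nlinarith [pow_nonneg (by norm_num : (0:ℝ) ≤ 29 / 32) (D.card - 1)]
  rw [Nat.add_sub_cancel]
  have h2q : (0 : ℝ) ≤ 2 ^ m := by positivity
  calc _ ≤ _ := h1
    _ ≤ _ := h2
    _ ≤ 5 * (29 / 32 : ℝ) ^ d * 2 ^ m := h3
    _ ≤ 5 * ((32 / 29) * (29 / 32 : ℝ) ^ D.card) * 2 ^ m := by gcongr
    _ = 160 / 29 * (29 / 32 : ℝ) ^ D.card * 2 ^ m := by ring

/-! ## (HC-Z) -/

/-- The statistic of (HC-Z) as a word weight: `2^{Z(v)} (√3/2)^{Z(v)} = (√3)^{Z(v)}`, at most the weight-`7/4` word weight. -/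
theorem two_pow_mul_sqrt_pow_le (v : Fin n → Bool) :
    (2 : ℝ) ^ Fib19.zeros v * (Real.sqrt 3 / 2) ^ Fib19.zeros v ≤ wordWt (fun _ => (7 / 4 : ℝ)) v := by
  have hs : Real.sqrt 3 ≤ 7 / 4 := by
    rw [show (7 / 4 : ℝ) = Real.sqrt ((7 / 4) ^ 2) by rw [Real.sqrt_sq (by norm_num)]]
    exact Real.sqrt_le_sqrt (by norm_num)
  have hs0 : 0 ≤ Real.sqrt 3 := Real.sqrt_nonneg 3
  rw [← mul_pow, show (2 : ℝ) * (Real.sqrt 3 / 2) = Real.sqrt 3 by ring]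
  have heq : Real.sqrt 3 ^ Fib19.zeros v = wordWt (fun _ => Real.sqrt 3) v := by
    unfold Fib19.zeros wordWt
    exact AffBells21.pow_card_filter_eq_prod_ite _ _
  rw [heq]
  exact wordWt_mono (fun _ => hs0) (fun _ => hs) v

/-- **(HC-Z) PROVED**: `Σ_{x odd} (√3/2)^{Z(J(x))} ≤ (160/39)·(39/40)^n·2^{n−1}` for `n ≥ 3`. -/
theorem kernelZerosMGF : KernelZerosMGF := by
  refine ⟨39 / 40, by norm_num, 160 / 39, fun n hn => ?_⟩
  obtain ⟨m, rfl⟩ : ∃ m, n = m + 1 := ⟨n - 1, by omega⟩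
  have hw0 : ∀ _ : ℕ, (0 : ℝ) ≤ 7 / 4 := fun _ => by norm_num
  have h1 := sum_odd_le_sum_hardCore hn (fun v => (Real.sqrt 3 / 2) ^ Fib19.zeros v) (fun v => by positivity)
  have h1' : ∑ v ∈ (univ.filter fun v : Fin (m + 1) → Bool => Fib19.HardCore v),
      (2 : ℝ) ^ Fib19.zeros v * (Real.sqrt 3 / 2) ^ Fib19.zeros v
        ≤ ∑ v ∈ (univ.filter fun v : Fin (m + 1) → Bool => Fib19.HardCore v), wordWt (fun _ => (7 / 4 : ℝ)) v :=
    sum_le_sum fun v _ => two_pow_mul_sqrt_pow_le v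
  have h2 := sum_hardCore_le_total (n := m + 1) (fun _ => (7 / 4 : ℝ)) hw0
  have h3 := total_le_seven_quarters (fun _ => (7 / 4 : ℝ)) hw0 (fun _ => le_rfl) m
  rw [Nat.add_sub_cancel]
  have hfin : (4 : ℝ) * (39 / 20 : ℝ) ^ m = 160 / 39 * (39 / 40 : ℝ) ^ (m + 1) * 2 ^ m := by
    rw [pow_succ, show (39 / 20 : ℝ) = (39 / 40) * 2 by norm_num, mul_pow]
    ring
  calc _ ≤ _ := h1
    _ ≤ _ := h1'
    _ ≤ _ := h2
    _ ≤ 4 * (39 / 20 : ℝ) ^ m := h3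
    _ = _ := hfin

end AffBells22

end Summit.QuantumAdvantage.AdviceFreeQNC0
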